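import Summits.QuantumFields.YangMills.Theorems.BalabanUVNodesN15KingModelPotentialAnalytic
import Summits.QuantumFields.YangMills.Theorems.BalabanUVNodesN15KingModelPotentialComplexLimit

/-!
# N15 (NE2) King-model rung, PART 30 — THE CONTINUUM-LIMIT COVARIANCE IS HOLOMORPHIC ALONG EVERY COMPLEX LINE THROUGH EVERY REAL POTENTIAL
# (Gâteaux holomorphy of the `k → ∞` limit on the whole real window; [B9] Theorem 3.4 template at `k = ∞`, base point free)

Tenth generation (g10) of the seat `pub-ymgap-dag-n15-d`, part 30 (on 29 `…PotentialAnalytic`, 28d `…PotentialComplexLimit`).  28d extends 10e's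
continuum limit from the real RAY `t·v` to the complex disc `z·v`; 29 makes every LEVEL analytic in a COMPLEX potential on the sup-ball.  Here, with a
BASE POINT: for real bounded coherent towers `v₀` (base, size `≤ u₀ < r_K`) and `v₁` (direction, size `≤ u₁`, `u₁ > 0`), the complex line `v₀ + z·v₁` stays
in 29's sup-ball for `‖z‖ < R := (r_K − u₀)∕u₁`, every level ∕ covariance is holomorphic there with k-uniform bounds, and at the REAL couplings `0 < t < 1`
the towers `v₀ + t·v₁` are in 10e's window (`u₀ + u₁ ≤ w₁`, `ν₀ + ν₁ ≤ w₁`).  Vitali (28c) ⇒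
* dictionaries `kingCovCPot_ofReal` ∕ `kingCovCPot_line_ofReal` ∕ `kingLevelCPot_ofReal` ∕ `kingLevelCPot_line_ofReal`; `analyticAt_kingCovCPot_line`,
  `analyticAt_kingLevelCPot_line` (29 composed with the affine line); `norm_effLaplacianCPot_apply_le` ∕ `norm_kingLevelCPot_apply_le` (levels `≤ a + 2a²∕m²`);
* ★★★ `king_continuumLimit_holomorphic_at` (with `f k z := C^{(k+1)}_{v₀ + z·v₁}(x,y)`: holomorphic Vitali limit on `ball 0 R`, locally uniform + pointwise
  convergence, derivatives, bound `2∕γ₀`, Cauchy's estimates for the limit, identification with 10e's `C^{(∞)}_{v₀ + t·v₁}(x,y)` at real `t`) — the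
  continuum-limit covariance is REAL-ANALYTIC on the whole real window with a holomorphic extension in EVERY direction at EVERY base point (28d: `v₀ = 0`);
* ★★★ `king_continuumLimit_operator_holomorphic_at`: along the line the levels converge too and the limits satisfy `(Δ^{(∞)} + aL⁻²Q*Q)·C^{(∞)} = 1`,
  `C^{(∞)} = (Δ^{(∞)} + aL⁻²Q*Q)⁻¹` at EVERY complex point of the disc (28d §4 base-point free).

PRINTED ANCHOR (template). [B9] = T. Bałaban, Commun. Math. Phys. **99** (1985) 389–434, Theorem 3.4 p. 400, (3.64)–(3.65) p. 402; King's model: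
C. King, Commun. Math. Phys. **102** (1986) 649–677, (4.32)–(4.34) p. 674, Lemma 4.5 (4.38) p. 674, §4 pp. 675–676 (A = 0).

HONEST SCOPE.  King's A = 0 SCALAR tower on the King-admissible tori `Π ℤ∕(2L^{e+1})` (odd `L ≥ 3`, `a, m² > 0`); REAL base and direction towers,
ONE complex parameter (Gâteaux holomorphy of the limit; joint analyticity of the limit in the complex potential would need Hartogs∕Osgood, not in
Mathlib); a potential is a mass insertion, NOT a gauge field ∕ NOT Bałaban's `U′U`; no decay off the real potentials; NOT a node discharge;
count-neutral.  No `sorry`, standard axioms, default heartbeats.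
-/

noncomputable section

open scoped BigOperators Matrix
open Filter Topology Metric Finset

namespace Summit.QuantumFields.YangMills.BalabanUVNodes.N15.KingModel

open Literature.MathematicalPhysics.QuantumFieldTheory.Balaban1983to89 hiding blockOf
open Literature.MathematicalPhysics.QuantumFieldTheory.Balaban1983to89.B5Prop11Plancherel (Tor fine)
open Literature.MathematicalPhysics.QuantumFieldTheory.Balaban1983to89.B5Prop11Lower (nsq nsq_nonneg)
open Literature.MathematicalPhysics.QuantumFieldTheory.King1986 (aK aK_pos aK_le)
open Literature.MathematicalPhysics.QuantumFieldTheory.King1986.Torus (Qmat gam0L gam0L_pos)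
open Summit.QuantumFields.YangMills.BalabanUVNodes.N15KingModelRung.Curved (underPtN)

variable {d : ℕ}

/-! ## §1 The affine complex line through a real base potential -/

section Line

variable {a m2 : ℝ} {L : ℕ} [NeZero L] {M : Fin (d + 1) → ℕ} [∀ μ, NeZero (M μ)]

/-- A real potential read over ℂ gives 28b's complex-coupling object at `z = 1`, hence 9c's real object: `kingCovCPot k ↑w = ((Δ^{(k)}_w + aL⁻²Q*Q)⁻¹).map ofReal`.
[folklore] -/
theorem kingCovCPot_ofReal (k : ℕ) (w : Tor (fine (L ^ k) (fine L M)) → ℝ) :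
    kingCovCPot d a m2 L M k (fun x => (w x : ℂ)) = ((kingLevelPot a m2 L M k w + kingBlock a L M)⁻¹).map Complex.ofReal := by
  have h := kingCovCPot_smul (d := d) (a := a) (m2 := m2) (L := L) (M := M) k 1 w
  simp only [one_mul] at h
  rw [h, ← Complex.ofReal_one, kingCovPotC_ofReal, one_smul]

/-- **DICTIONARY ON THE LINE**: at a real coupling `t` and a level `j ≥ 1`, the complex-potential covariance at `v₀ + t·v₁` (level-`j` members) IS 10e's
`kingCovE (fullPert (v₀ + t·v₁)) j`, read over ℂ. [cite: King1986, (4.32) p.674 (A = 0 template)] -/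
theorem kingCovCPot_line_ofReal (v₀ v₁ : ∀ N : ℕ, Tor (fine N (fine L M)) → ℝ) {j : ℕ} (hj : 1 ≤ j) (t : ℝ) (x y : Tor (fine L M)) :
    kingCovCPot d a m2 L M j (fun x' => (v₀ (L ^ j) x' : ℂ) + (t : ℂ) * (v₁ (L ^ j) x' : ℂ)) x y
      = ((kingCovE a m2 L M (fullPert a m2 L M (v₀ + t • v₁)) j x y : ℝ) : ℂ) := by
  have hfun : (fun x' => (v₀ (L ^ j) x' : ℂ) + (t : ℂ) * (v₁ (L ^ j) x' : ℂ)) = fun x' => (((v₀ + t • v₁) (L ^ j) x' : ℝ) : ℂ) := by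
    funext x'
    simp only [Pi.add_apply, Pi.smul_apply, smul_eq_mul, Complex.ofReal_add, Complex.ofReal_mul]
  rw [hfun, kingCovCPot_ofReal, kingCovE_fullPert, kingTowerPot_of_one_le _ hj, Matrix.map_apply]

/-- **Along the affine complex line the level is ANALYTIC in `z`**: for `L ≥ 2`, `a, m² > 0`, `k ≥ 1`, complex potentials `w₀, w₁` and `z` with
`‖w₀ x + z·w₁ x‖ ≤ ρ ≤ r_K` for all `x`, `AnalyticAt ℂ (ζ ↦ C^{(k)}_{w₀ + ζ·w₁}(x,y)) z` (part 29's joint analyticity composed with the affine line).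
[cite: Balaban1985BackgroundPropagators, Thm 3.4 p.400 (template)] -/
theorem analyticAt_kingCovCPot_line (ha : 0 < a) (hm : 0 < m2) (hL : 2 ≤ L) {k : ℕ} (hk : 1 ≤ k)
    (w₀ w₁ : Tor (fine (L ^ k) (fine L M)) → ℂ) {z : ℂ} {ρ : ℝ} (hρ0 : 0 ≤ ρ) (hρ : ∀ x, ‖w₀ x + z * w₁ x‖ ≤ ρ) (hρK : ρ ≤ cplxWindow d a m2 L)
    (x y : Tor (fine L M)) :
    AnalyticAt ℂ (fun ζ : ℂ => kingCovCPot d a m2 L M k (fun x' => w₀ x' + ζ * w₁ x') x y) z := by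
  have hline : AnalyticAt ℂ (fun ζ : ℂ => (fun x' => w₀ x' + ζ * w₁ x' : Tor (fine (L ^ k) (fine L M)) → ℂ)) z := by
    have h1 : AnalyticAt ℂ (fun ζ : ℂ => (fun x' => ζ * w₁ x' : Tor (fine (L ^ k) (fine L M)) → ℂ)) z := by
      have hlin : AnalyticAt ℂ (fun ζ : ℂ => ζ • w₁) z := (ContinuousLinearMap.id ℂ ℂ).analyticAt z |>.smul analyticAt_const
      refine hlin.congr (Filter.Eventually.of_forall fun ζ => ?_)
      funext x'
      simp only [Pi.smul_apply, smul_eq_mul]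
    have h2 : AnalyticAt ℂ (fun _ : ℂ => w₀) z := analyticAt_const
    have h := h2.add h1
    refine h.congr (Filter.Eventually.of_forall fun ζ => ?_)
    funext x'
    simp only [Pi.add_apply]
  exact (analyticAt_kingCovCPot_apply ha hm hL hk hρ0 hρ hρK x y).comp hline

/-- A real potential read over ℂ: `kingLevelCPot k ↑w = (Δ^{(k)}_w).map ofReal`. [folklore] -/
theorem kingLevelCPot_ofReal (k : ℕ) (w : Tor (fine (L ^ k) (fine L M)) → ℝ) :
    kingLevelCPot d a m2 L M k (fun x => (w x : ℂ)) = (kingLevelPot a m2 L M k w).map Complex.ofReal := by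
  have h : kingLevelCPot d a m2 L M k (fun x => (1 : ℂ) * (w x : ℂ)) = kingLevelPotC d a m2 L M k 1 w := by
    rw [kingLevelCPot, kingLevelPotC, effLaplacianCPot_smul]
  simp only [one_mul] at h
  rw [h, ← Complex.ofReal_one, kingLevelPotC_ofReal, one_smul]

/-- **DICTIONARY ON THE LINE, LEVELS**: at a real coupling `t` and a level `j ≥ 1`, the complex-potential level at `v₀ + t·v₁` IS 9c's `kingTowerPot (v₀ + t·v₁) j`,
read over ℂ. [folklore] -/
theorem kingLevelCPot_line_ofReal (v₀ v₁ : ∀ N : ℕ, Tor (fine N (fine L M)) → ℝ) {j : ℕ} (hj : 1 ≤ j) (t : ℝ) (b b' : Tor (fine L M)) :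
    kingLevelCPot d a m2 L M j (fun x' => (v₀ (L ^ j) x' : ℂ) + (t : ℂ) * (v₁ (L ^ j) x' : ℂ)) b b'
      = ((kingTowerPot a m2 L M (v₀ + t • v₁) j b b' : ℝ) : ℂ) := by
  have hfun : (fun x' => (v₀ (L ^ j) x' : ℂ) + (t : ℂ) * (v₁ (L ^ j) x' : ℂ)) = fun x' => (((v₀ + t • v₁) (L ^ j) x' : ℝ) : ℂ) := by
    funext x'
    simp only [Pi.add_apply, Pi.smul_apply, smul_eq_mul, Complex.ofReal_add, Complex.ofReal_mul]
  rw [hfun, kingLevelCPot_ofReal, kingTowerPot_of_one_le _ hj, Matrix.map_apply]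

/-- **THE LEVEL ENTRIES ARE BOUNDED ON THE COMPLEX SUP-BALL**: for `a, c ≥ 0`, `m² > 0`, `‖w x‖ ≤ w₀ ≤ m²∕2`, `‖Δ_eff(w)(b,b′)‖ ≤ a + 2a²∕m²` (28d §3 at a
complex potential). [cite: King1986, (2.14) p.653, (4.5) p.670 (A = 0)] -/
theorem norm_effLaplacianCPot_apply_le {N : ℕ} [NeZero N] {U : Fin (d + 1) → ℕ} [∀ μ, NeZero (U μ)] {c : ℝ} (ha : 0 ≤ a) (hc : 0 ≤ c) (hm : 0 < m2)
    {w : Tor (fine N U) → ℂ} {w₀ : ℝ} (hw : ∀ x, ‖w x‖ ≤ w₀) (hwm : w₀ ≤ m2 / 2) (b b' : Tor U) :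
    ‖effLaplacianCPot N U a c m2 w b b'‖ ≤ a + 2 * a ^ 2 / m2 := by
  have hm2 : 0 < m2 / 2 := by linarith
  have hS : ∀ x, (m2 / 2) * nsq x ≤ (star x ⬝ᵥ fineOpCPot N U a c m2 w *ᵥ x).re :=
    reCoercive_mono (reCoercive_fineOpCPot ha hc hw) (by linarith)
  have hNpos : 0 < (((N : ℕ) : ℝ) ^ (d + 1)) := pow_pos (Nat.cast_pos.mpr (Nat.pos_of_ne_zero (NeZero.ne N))) _
  have hN : (((N : ℕ) : ℝ) ^ (d + 1)) ≠ 0 := hNpos.ne'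
  have hsq : Real.sqrt ((((N : ℕ) : ℝ) ^ (d + 1))⁻¹) * Real.sqrt ((((N : ℕ) : ℝ) ^ (d + 1))⁻¹) = ((((N : ℕ) : ℝ) ^ (d + 1))⁻¹) :=
    Real.mul_self_sqrt (inv_nonneg.mpr hNpos.le)
  have hsand : ‖((Qmat N U).map Complex.ofReal * (fineOpCPot N U a c m2 w)⁻¹ * ((Qmat N U).map Complex.ofReal)ᵀ) b b'‖
      ≤ (m2 / 2)⁻¹ * (((N : ℕ) : ℝ) ^ (d + 1))⁻¹ := by
    rw [sandwichC_apply_eq]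
    refine (norm_star_dotProduct_inv_mulVec_le hm2 hS _ _).trans (le_of_eq ?_)
    rw [nsq_QmatC_row, nsq_QmatC_row, hsq]
  unfold effLaplacianCPot
  rw [Matrix.sub_apply, Matrix.smul_apply, Matrix.smul_apply, smul_eq_mul, smul_eq_mul]
  have hcoeff : ‖(((a ^ 2 * (N : ℝ) ^ (d + 1) : ℝ)) : ℂ)‖ = a ^ 2 * (N : ℝ) ^ (d + 1) := Complex.norm_of_nonneg (by positivity)
  have h1 : ‖(a : ℂ) * (1 : Matrix (Tor U) (Tor U) ℂ) b b'‖ ≤ a := by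
    rw [norm_mul, Complex.norm_real, Real.norm_eq_abs, abs_of_nonneg ha, Matrix.one_apply]
    split_ifs <;> simp [ha]
  have h2 : ‖(((a ^ 2 * (N : ℝ) ^ (d + 1) : ℝ)) : ℂ)
      * ((Qmat N U).map Complex.ofReal * (fineOpCPot N U a c m2 w)⁻¹ * ((Qmat N U).map Complex.ofReal)ᵀ) b b'‖
      ≤ a ^ 2 * (N : ℝ) ^ (d + 1) * ((m2 / 2)⁻¹ * (((N : ℕ) : ℝ) ^ (d + 1))⁻¹) := by
    rw [norm_mul, hcoeff]
    exact mul_le_mul_of_nonneg_left hsand (by positivity)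
  calc ‖(a : ℂ) * (1 : Matrix (Tor U) (Tor U) ℂ) b b'
        - (((a ^ 2 * (N : ℝ) ^ (d + 1) : ℝ)) : ℂ) * ((Qmat N U).map Complex.ofReal * (fineOpCPot N U a c m2 w)⁻¹ * ((Qmat N U).map Complex.ofReal)ᵀ) b b'‖
      ≤ a + a ^ 2 * (N : ℝ) ^ (d + 1) * ((m2 / 2)⁻¹ * (((N : ℕ) : ℝ) ^ (d + 1))⁻¹) := (norm_sub_le _ _).trans (add_le_add h1 h2)
    _ = a + 2 * a ^ 2 / m2 := by field_simp

/-- **KING'S LEVELS ARE BOUNDED ON THE COMPLEX SUP-BALL, UNIFORMLY IN `k`**: `‖Δ^{(k)}_w(b,b′)‖ ≤ a + 2a²∕m²` for `‖w x‖ ≤ w₀ ≤ r_K` (`k ≥ 1`). [cite: King1986, (2.13)–(2.14) p.653 (A = 0)] -/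
theorem norm_kingLevelCPot_apply_le (ha : 0 < a) (hm : 0 < m2) (hL : 2 ≤ L) {k : ℕ} (hk : 1 ≤ k)
    {w : Tor (fine (L ^ k) (fine L M)) → ℂ} {w₀ : ℝ} (hw : ∀ x, ‖w x‖ ≤ w₀) (hwK : w₀ ≤ cplxWindow d a m2 L) (b b' : Tor (fine L M)) :
    ‖kingLevelCPot d a m2 L M k w b b'‖ ≤ a + 2 * a ^ 2 / m2 := by
  have hLr : (1 : ℝ) < L := by exact_mod_cast (by omega : 1 < L)
  have haK := aK_pos ha hLr hk
  have haKle := aK_le ha hLr hk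
  have h := norm_effLaplacianCPot_apply_le (N := L ^ k) (U := fine L M) (c := ((L ^ k : ℕ) : ℝ) ^ 2) (a := aK a L k) (m2 := m2)
    haK.le (by positivity) hm hw (hwK.trans (min_le_left _ _)) b b'
  refine h.trans ?_
  have hsq : aK a L k ^ 2 ≤ a ^ 2 := pow_le_pow_left₀ haK.le haKle 2
  have h2 : 2 * aK a L k ^ 2 / m2 ≤ 2 * a ^ 2 / m2 := by
    rw [div_le_div_iff_of_pos_right hm]; linarith
  linarith

/-- **Along the affine complex line the LEVEL is analytic in `z`** (`‖w₀ x + z·w₁ x‖ ≤ ρ < m²`). [folklore] -/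
theorem analyticAt_kingLevelCPot_line (ha : 0 < a) (hL : 2 ≤ L) {k : ℕ} (hk : 1 ≤ k)
    (w₀ w₁ : Tor (fine (L ^ k) (fine L M)) → ℂ) {z : ℂ} {ρ : ℝ} (hρ : ∀ x, ‖w₀ x + z * w₁ x‖ ≤ ρ) (hρm : ρ < m2) (b b' : Tor (fine L M)) :
    AnalyticAt ℂ (fun ζ : ℂ => kingLevelCPot d a m2 L M k (fun x' => w₀ x' + ζ * w₁ x') b b') z := by
  have hline : AnalyticAt ℂ (fun ζ : ℂ => (fun x' => w₀ x' + ζ * w₁ x' : Tor (fine (L ^ k) (fine L M)) → ℂ)) z := by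
    have h1 : AnalyticAt ℂ (fun ζ : ℂ => (fun x' => ζ * w₁ x' : Tor (fine (L ^ k) (fine L M)) → ℂ)) z := by
      have hlin : AnalyticAt ℂ (fun ζ : ℂ => ζ • w₁) z := (ContinuousLinearMap.id ℂ ℂ).analyticAt z |>.smul analyticAt_const
      refine hlin.congr (Filter.Eventually.of_forall fun ζ => ?_)
      funext x'
      simp only [Pi.smul_apply, smul_eq_mul]
    have h := (analyticAt_const (v := w₀)).add h1
    refine h.congr (Filter.Eventually.of_forall fun ζ => ?_)
    funext x'
    simp only [Pi.add_apply]
  exact (analyticAt_kingLevelCPot_apply ha hL hk hρ hρm b b').comp hline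

end Line

/-! ## §2 The holomorphic continuum limit along every line through every real base point -/

section Limit

variable (L : ℕ) [NeZero L]

omit [NeZero L] in
/-- The size of the real tower `v₀ + t·v₁` (`t > 0`). [folklore] -/
theorem abs_line_le {e : ℕ} {v₀ v₁ : ∀ N : ℕ, Tor (fine N (kingU d L e)) → ℝ} {u₀ u₁ t : ℝ} (ht0 : 0 < t)
    (hv₀ : ∀ (N : ℕ) (x : Tor (fine N (kingU d L e))), |v₀ N x| ≤ u₀) (hv₁ : ∀ (N : ℕ) (x : Tor (fine N (kingU d L e))), |v₁ N x| ≤ u₁)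
    (N : ℕ) (x : Tor (fine N (kingU d L e))) : |(v₀ + t • v₁) N x| ≤ u₀ + t * u₁ := by
  show |v₀ N x + t * v₁ N x| ≤ u₀ + t * u₁
  calc |v₀ N x + t * v₁ N x| ≤ |v₀ N x| + |t * v₁ N x| := abs_add_le _ _
    _ ≤ u₀ + t * u₁ := by
        rw [abs_mul, abs_of_pos ht0]
        exact add_le_add (hv₀ N x) (mul_le_mul_of_nonneg_left (hv₁ N x) ht0.le)

omit [NeZero L] in
/-- The coherence defect of the real tower `v₀ + t·v₁` (`t > 0`). [folklore] -/
theorem coherence_line_le {e : ℕ} {v₀ v₁ : ∀ N : ℕ, Tor (fine N (kingU d L e)) → ℝ} {ν₀ ν₁ s t : ℝ} (ht0 : 0 < t)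
    (hcoh₀ : ∀ (k : ℕ), 1 ≤ k → ∀ x' : Tor (fine (L ^ 1 * L ^ k) (kingU d L e)),
      |v₀ (L ^ 1 * L ^ k) x' - v₀ (L ^ k) (underPtN L k 1 (kingU d L e) x')| ≤ ν₀ * s ^ k)
    (hcoh₁ : ∀ (k : ℕ), 1 ≤ k → ∀ x' : Tor (fine (L ^ 1 * L ^ k) (kingU d L e)),
      |v₁ (L ^ 1 * L ^ k) x' - v₁ (L ^ k) (underPtN L k 1 (kingU d L e) x')| ≤ ν₁ * s ^ k)
    (k : ℕ) (hk : 1 ≤ k) (x' : Tor (fine (L ^ 1 * L ^ k) (kingU d L e))) :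
    |(v₀ + t • v₁) (L ^ 1 * L ^ k) x' - (v₀ + t • v₁) (L ^ k) (underPtN L k 1 (kingU d L e) x')| ≤ (ν₀ + t * ν₁) * s ^ k := by
  show |v₀ (L ^ 1 * L ^ k) x' + t * v₁ (L ^ 1 * L ^ k) x' - (v₀ (L ^ k) (underPtN L k 1 (kingU d L e) x')
    + t * v₁ (L ^ k) (underPtN L k 1 (kingU d L e) x'))| ≤ (ν₀ + t * ν₁) * s ^ k
  have e1 : v₀ (L ^ 1 * L ^ k) x' + t * v₁ (L ^ 1 * L ^ k) x' - (v₀ (L ^ k) (underPtN L k 1 (kingU d L e) x')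
      + t * v₁ (L ^ k) (underPtN L k 1 (kingU d L e) x'))
      = (v₀ (L ^ 1 * L ^ k) x' - v₀ (L ^ k) (underPtN L k 1 (kingU d L e) x'))
        + t * (v₁ (L ^ 1 * L ^ k) x' - v₁ (L ^ k) (underPtN L k 1 (kingU d L e) x')) := by ring
  rw [e1]
  refine (abs_add_le _ _).trans ?_
  rw [abs_mul, abs_of_pos ht0, add_mul, mul_assoc]
  exact add_le_add (hcoh₀ k hk x') (mul_le_mul_of_nonneg_left (hcoh₁ k hk x') ht0.le)

omit [NeZero L] in
/-- The complex line stays in the sup-ball: `‖v₀ N x + z·v₁ N x‖ ≤ u₀ + ‖z‖·u₁`. [folklore] -/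
theorem norm_cline_le {e : ℕ} {v₀ v₁ : ∀ N : ℕ, Tor (fine N (kingU d L e)) → ℝ} {u₀ u₁ : ℝ}
    (hv₀ : ∀ (N : ℕ) (x : Tor (fine N (kingU d L e))), |v₀ N x| ≤ u₀) (hv₁ : ∀ (N : ℕ) (x : Tor (fine N (kingU d L e))), |v₁ N x| ≤ u₁)
    (z : ℂ) (N : ℕ) (x' : Tor (fine N (kingU d L e))) : ‖(v₀ N x' : ℂ) + z * (v₁ N x' : ℂ)‖ ≤ u₀ + ‖z‖ * u₁ := by
  calc ‖(v₀ N x' : ℂ) + z * (v₁ N x' : ℂ)‖ ≤ ‖(v₀ N x' : ℂ)‖ + ‖z * (v₁ N x' : ℂ)‖ := norm_add_le _ _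
    _ ≤ u₀ + ‖z‖ * u₁ := by
        rw [norm_mul, Complex.norm_real, Complex.norm_real, Real.norm_eq_abs, Real.norm_eq_abs]
        exact add_le_add (hv₀ N x') (mul_le_mul_of_nonneg_left (hv₁ N x') (norm_nonneg z))

/-- ★★★ **THE CONTINUUM-LIMIT DRESSED COVARIANCE IS HOLOMORPHIC ALONG EVERY COMPLEX LINE THROUGH EVERY REAL POTENTIAL OF THE WINDOW** (hypotheses and
the seven conclusions (i)–(vii) as in 28d's `king_continuumLimit_holomorphic`, with `f k z := C^{(k+1)}_{v₀ + z·v₁}(x,y)`, `R := (r_K − u₀)∕u₁`, the base ∕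
direction towers `v₀, v₁` real, bounded (`u₀ < r_K`, `u₀ + u₁ ≤ w₁`, `u₁ > 0`) and coherent (`ν₀ + ν₁ ≤ w₁`); 28d is the case `v₀ = 0`).
[cite: Balaban1985BackgroundPropagators, Thm 3.4 p.400, (3.64)–(3.65) p.402 (template); King1986, Lemma 4.5 (4.38) p.674, §4 pp.675–676 (A = 0)] -/
theorem king_continuumLimit_holomorphic_at (hLodd : Odd L) (hL : 2 ≤ L) {a m2 : ℝ} (ha : 0 < a) (hm : 0 < m2) :
    ∃ w₁ : ℝ, 0 < w₁ ∧
      ∀ (e : ℕ) (v₀ v₁ : ∀ N : ℕ, Tor (fine N (kingU d L e)) → ℝ) (u₀ u₁ ν₀ ν₁ s : ℝ),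
      0 ≤ ν₀ → 0 ≤ ν₁ → ν₀ + ν₁ ≤ w₁ → 0 ≤ s → s ≤ (L : ℝ) ^ (-(1 / 2 : ℝ)) →
      0 ≤ u₀ → 0 < u₁ → u₀ < cplxWindow d a m2 L → u₀ + u₁ ≤ w₁ →
      (∀ (N : ℕ) (x : Tor (fine N (kingU d L e))), |v₀ N x| ≤ u₀) → (∀ (N : ℕ) (x : Tor (fine N (kingU d L e))), |v₁ N x| ≤ u₁) →
      (∀ (k : ℕ), 1 ≤ k → ∀ x' : Tor (fine (L ^ 1 * L ^ k) (kingU d L e)),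
          |v₀ (L ^ 1 * L ^ k) x' - v₀ (L ^ k) (underPtN L k 1 (kingU d L e) x')| ≤ ν₀ * s ^ k) →
      (∀ (k : ℕ), 1 ≤ k → ∀ x' : Tor (fine (L ^ 1 * L ^ k) (kingU d L e)),
          |v₁ (L ^ 1 * L ^ k) x' - v₁ (L ^ k) (underPtN L k 1 (kingU d L e) x')| ≤ ν₁ * s ^ k) →
      ∀ x y : Tor (kingU d L e),
        let f : ℕ → ℂ → ℂ := fun k z =>
          kingCovCPot d a m2 L (kingM d L e) (k + 1) (fun x' => (v₀ (L ^ (k + 1)) x' : ℂ) + z * (v₁ (L ^ (k + 1)) x' : ℂ)) x y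
        let R : ℝ := (cplxWindow d a m2 L - u₀) / u₁
        DifferentiableOn ℂ (vitaliLim f) (ball 0 R) ∧
        TendstoLocallyUniformlyOn f (vitaliLim f) atTop (ball 0 R) ∧
        (∀ z ∈ ball 0 R, Tendsto (fun k => f k z) atTop (𝓝 (vitaliLim f z))) ∧
        TendstoLocallyUniformlyOn (fun k => deriv (f k)) (deriv (vitaliLim f)) atTop (ball 0 R) ∧
        (∀ z ∈ ball 0 R, ‖vitaliLim f z‖ ≤ 2 / gam0L (d + 1) a L) ∧
        (∀ (z₀ : ℂ) (r : ℝ), 0 < r → closedBall z₀ r ⊆ ball 0 R → ∀ n : ℕ,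
            ‖iteratedDeriv n (vitaliLim f) z₀‖ ≤ n.factorial * (2 / gam0L (d + 1) a L) / r ^ n) ∧
        (∀ z ∈ ball 0 R, ∀ l : ℂ, Tendsto (fun k => f k z) atTop (𝓝 l) → vitaliLim f z = l) := by
  obtain ⟨κ, w₁, C, hκ, hw₁, hC, H⟩ := king_continuumLimit_W (d := d) L hLodd hL ha hm
  refine ⟨w₁, hw₁, ?_⟩
  intro e v₀ v₁ u₀ u₁ ν₀ ν₁ s hν₀ hν₁ hνw hs0 hs1 hu₀ hu₁ hu₀K huw hv₀ hv₁ hcoh₀ hcoh₁ x y f R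
  have hγ := gam0L_pos (d := d + 1) ha hL
  have hR : 0 < R := div_pos (by linarith) hu₁
  -- (a) on the ball the line stays inside part 29's sup-ball
  have hzw : ∀ z ∈ ball (0 : ℂ) R, ∀ (N : ℕ) (x' : Tor (fine N (kingU d L e))), ‖(v₀ N x' : ℂ) + z * (v₁ N x' : ℂ)‖ ≤ u₀ + ‖z‖ * u₁ :=
    fun z _ N x' => norm_cline_le L hv₀ hv₁ z N x'
  have hzK : ∀ z ∈ ball (0 : ℂ) R, u₀ + ‖z‖ * u₁ ≤ cplxWindow d a m2 L := by
    intro z hz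
    rw [mem_ball_zero_iff] at hz
    have : ‖z‖ * u₁ < (cplxWindow d a m2 L - u₀) / u₁ * u₁ := mul_lt_mul_of_pos_right hz hu₁
    rw [div_mul_cancel₀ _ hu₁.ne'] at this
    linarith
  have hz0 : ∀ z ∈ ball (0 : ℂ) R, 0 ≤ u₀ + ‖z‖ * u₁ := fun z _ => by positivity
  have hd : ∀ k, DifferentiableOn ℂ (f k) (ball 0 R) := fun k z hz =>
    (analyticAt_kingCovCPot_line (M := kingM d L e) ha hm hL (Nat.succ_le_succ (Nat.zero_le k)) _ _ (hz0 z hz) (hzw z hz _) (hzK z hz) x y)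
      |>.differentiableAt.differentiableWithinAt
  -- (b) the k-uniform bound
  have hb : ∀ k, ∀ z ∈ ball (0 : ℂ) R, ‖f k z‖ ≤ 2 / gam0L (d + 1) a L := fun k z hz =>
    kingCovCPot_apply_norm_le (M := kingM d L e) ha hm hL (Nat.succ_le_succ (Nat.zero_le k)) (hz0 z hz) (hzw z hz _) (hzK z hz) x y
  -- (c) convergence at the real couplings 0 < t < 1 (part 10e on the real tower v₀ + t·v₁)
  have hconv : ∀ t : ℝ, 0 < t → t < 1 → ∃ l : ℂ, Tendsto (fun k => f k (t : ℂ)) atTop (𝓝 l) := by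
    intro t ht0 ht1
    have hvt := abs_line_le L (u₀ := u₀) (u₁ := u₁) ht0 hv₀ hv₁
    have hcoht := coherence_line_le L (ν₀ := ν₀) (ν₁ := ν₁) (s := s) ht0 hcoh₀ hcoh₁
    have htw : u₀ + t * u₁ ≤ w₁ := by nlinarith
    have htν : ν₀ + t * ν₁ ≤ w₁ := by nlinarith
    have htν0 : 0 ≤ ν₀ + t * ν₁ := by positivity
    obtain ⟨Dinf, Cinf, -, -, -, -, hlim, -, -⟩ := H e (v₀ + t • v₁) (u₀ + t * u₁) (ν₀ + t * ν₁) s htν0 htν hs0 hs1 hvt htw hcoht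
    refine ⟨(Cinf x y : ℂ), ?_⟩
    have h1 : Tendsto (fun k => ((kingCovE a m2 L (kingM d L e) (fullPert a m2 L (kingM d L e) (v₀ + t • v₁)) (k + 1) x y : ℝ) : ℂ)) atTop
        (𝓝 (Cinf x y : ℂ)) :=
      ((Complex.continuous_ofReal.tendsto _).comp (hlim x y)).comp (tendsto_add_atTop_nat 1)
    refine h1.congr fun k => ?_
    exact (kingCovCPot_line_ofReal v₀ v₁ (Nat.succ_le_succ (Nat.zero_le k)) t x y).symm
  -- (d) Vitali
  have hV := vitali_disc hR one_pos hd hb hconv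
  refine ⟨hV.1, hV.2.1, hV.2.2, (vitali_disc_deriv hR one_pos hd hb hconv).1, fun z hz => norm_vitaliLim_le hR one_pos hd hb hconv hz,
    fun z₀ r hr hsub n => norm_iteratedDeriv_vitaliLim_le hR one_pos hd hb hconv hr hsub n,
    fun z hz l hl => vitaliLim_eq_of_tendsto hR one_pos hd hb hconv hz hl⟩

/-- ★★★ **THE INVERSE IDENTITY ALONG EVERY COMPLEX LINE THROUGH EVERY REAL BASE POINT, HOLOMORPHICALLY** (28d §4 base-point free): under the
hypotheses of `king_continuumLimit_holomorphic_at`, for every `z ∈ ball 0 R` (`R = (r_K − u₀)∕u₁`) there are matrices `D∞ C∞` on the unit torus whose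
entries are the Vitali limits of the levels `Δ^{(k+1)}_{v₀ + z·v₁}(b,b′)` ∕ covariances `C^{(k+1)}_{v₀ + z·v₁}(x,y)` (each entry a holomorphic function
of `z` on the ball, the levels ∕ covariances converging to it), with `(D∞ + aL⁻²Q*Q)·C∞ = 1`, `C∞ = (D∞ + aL⁻²Q*Q)⁻¹`, `‖D∞(b,b′)‖ ≤ a + 2a²∕m²`,
`‖C∞(x,y)‖ ≤ 2∕γ₀`. [cite: Balaban1985BackgroundPropagators, Thm 3.4 p.400 (template); King1986, (4.32)–(4.34) p.674, §4 pp.675–676 (A = 0)] -/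
theorem king_continuumLimit_operator_holomorphic_at (hLodd : Odd L) (hL : 2 ≤ L) {a m2 : ℝ} (ha : 0 < a) (hm : 0 < m2) :
    ∃ w₁ : ℝ, 0 < w₁ ∧
      ∀ (e : ℕ) (v₀ v₁ : ∀ N : ℕ, Tor (fine N (kingU d L e)) → ℝ) (u₀ u₁ ν₀ ν₁ s : ℝ),
      0 ≤ ν₀ → 0 ≤ ν₁ → ν₀ + ν₁ ≤ w₁ → 0 ≤ s → s ≤ (L : ℝ) ^ (-(1 / 2 : ℝ)) →
      0 ≤ u₀ → 0 < u₁ → u₀ < cplxWindow d a m2 L → u₀ + u₁ ≤ w₁ →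
      (∀ (N : ℕ) (x : Tor (fine N (kingU d L e))), |v₀ N x| ≤ u₀) → (∀ (N : ℕ) (x : Tor (fine N (kingU d L e))), |v₁ N x| ≤ u₁) →
      (∀ (k : ℕ), 1 ≤ k → ∀ x' : Tor (fine (L ^ 1 * L ^ k) (kingU d L e)),
          |v₀ (L ^ 1 * L ^ k) x' - v₀ (L ^ k) (underPtN L k 1 (kingU d L e) x')| ≤ ν₀ * s ^ k) →
      (∀ (k : ℕ), 1 ≤ k → ∀ x' : Tor (fine (L ^ 1 * L ^ k) (kingU d L e)),
          |v₁ (L ^ 1 * L ^ k) x' - v₁ (L ^ k) (underPtN L k 1 (kingU d L e) x')| ≤ ν₁ * s ^ k) →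
      let R : ℝ := (cplxWindow d a m2 L - u₀) / u₁
      let Dk : ℕ → ℂ → Matrix (Tor (kingU d L e)) (Tor (kingU d L e)) ℂ := fun k z =>
        kingLevelCPot d a m2 L (kingM d L e) (k + 1) (fun x' => (v₀ (L ^ (k + 1)) x' : ℂ) + z * (v₁ (L ^ (k + 1)) x' : ℂ))
      let Ck : ℕ → ℂ → Matrix (Tor (kingU d L e)) (Tor (kingU d L e)) ℂ := fun k z =>
        kingCovCPot d a m2 L (kingM d L e) (k + 1) (fun x' => (v₀ (L ^ (k + 1)) x' : ℂ) + z * (v₁ (L ^ (k + 1)) x' : ℂ))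
      ∀ z ∈ ball (0 : ℂ) R,
        let Dinf : Matrix (Tor (kingU d L e)) (Tor (kingU d L e)) ℂ := fun b b' => vitaliLim (fun k ζ => Dk k ζ b b') z
        let Cinf : Matrix (Tor (kingU d L e)) (Tor (kingU d L e)) ℂ := fun x y => vitaliLim (fun k ζ => Ck k ζ x y) z
        (∀ b b', DifferentiableOn ℂ (fun ζ => vitaliLim (fun k ζ' => Dk k ζ' b b') ζ) (ball 0 R) ∧
            Tendsto (fun k => Dk k z b b') atTop (𝓝 (Dinf b b')) ∧ ‖Dinf b b'‖ ≤ a + 2 * a ^ 2 / m2) ∧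
        (∀ x y, DifferentiableOn ℂ (fun ζ => vitaliLim (fun k ζ' => Ck k ζ' x y) ζ) (ball 0 R) ∧
            Tendsto (fun k => Ck k z x y) atTop (𝓝 (Cinf x y)) ∧ ‖Cinf x y‖ ≤ 2 / gam0L (d + 1) a L) ∧
        (Dinf + (kingBlock a L (kingM d L e)).map Complex.ofReal) * Cinf = 1 ∧
        Cinf = (Dinf + (kingBlock a L (kingM d L e)).map Complex.ofReal)⁻¹ := by
  obtain ⟨κ, w₁, C, hκ, hw₁, hC, H⟩ := king_continuumLimit_W (d := d) L hLodd hL ha hm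
  obtain ⟨w₁', hw₁', H'⟩ := king_continuumLimit_holomorphic_at (d := d) L hLodd hL ha hm
  refine ⟨min w₁ w₁', lt_min hw₁ hw₁', ?_⟩
  intro e v₀ v₁ u₀ u₁ ν₀ ν₁ s hν₀ hν₁ hνw hs0 hs1 hu₀ hu₁ hu₀K huw hv₀ hv₁ hcoh₀ hcoh₁ R Dk Ck z hz Dinf Cinf
  have hνwa : ν₀ + ν₁ ≤ w₁ := hνw.trans (min_le_left _ _)
  have hνwb : ν₀ + ν₁ ≤ w₁' := hνw.trans (min_le_right _ _)
  have huwa : u₀ + u₁ ≤ w₁ := huw.trans (min_le_left _ _)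
  have huwb : u₀ + u₁ ≤ w₁' := huw.trans (min_le_right _ _)
  have hγ := gam0L_pos (d := d + 1) ha hL
  have hR : 0 < R := div_pos (by linarith) hu₁
  have hzw : ∀ z ∈ ball (0 : ℂ) R, ∀ (N : ℕ) (x' : Tor (fine N (kingU d L e))), ‖(v₀ N x' : ℂ) + z * (v₁ N x' : ℂ)‖ ≤ u₀ + ‖z‖ * u₁ :=
    fun z _ N x' => norm_cline_le L hv₀ hv₁ z N x'
  have hzK : ∀ z ∈ ball (0 : ℂ) R, u₀ + ‖z‖ * u₁ ≤ cplxWindow d a m2 L := by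
    intro z hz
    rw [mem_ball_zero_iff] at hz
    have : ‖z‖ * u₁ < (cplxWindow d a m2 L - u₀) / u₁ * u₁ := mul_lt_mul_of_pos_right hz hu₁
    rw [div_mul_cancel₀ _ hu₁.ne'] at this
    linarith
  -- (A) Vitali for the LEVELS along the line, entry by entry
  have hLev : ∀ b b' : Tor (kingU d L e),
      DifferentiableOn ℂ (vitaliLim (fun k ζ => Dk k ζ b b')) (ball 0 R) ∧
        (∀ z ∈ ball (0 : ℂ) R, Tendsto (fun k => Dk k z b b') atTop (𝓝 (vitaliLim (fun k ζ => Dk k ζ b b') z))) ∧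
        ∀ z ∈ ball (0 : ℂ) R, ‖vitaliLim (fun k ζ => Dk k ζ b b') z‖ ≤ a + 2 * a ^ 2 / m2 := by
    intro b b'
    have hd : ∀ k, DifferentiableOn ℂ (fun ζ => Dk k ζ b b') (ball 0 R) := by
      intro k ζ hζ
      have hm' : u₀ + ‖ζ‖ * u₁ < m2 := lt_of_le_of_lt ((hzK ζ hζ).trans (min_le_left _ _)) (by linarith)
      exact (analyticAt_kingLevelCPot_line (M := kingM d L e) ha hL (Nat.succ_le_succ (Nat.zero_le k)) _ _ (hzw ζ hζ _) hm' b b')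
        |>.differentiableAt.differentiableWithinAt
    have hb : ∀ k, ∀ ζ ∈ ball (0 : ℂ) R, ‖Dk k ζ b b'‖ ≤ a + 2 * a ^ 2 / m2 := fun k ζ hζ =>
      norm_kingLevelCPot_apply_le (M := kingM d L e) ha hm hL (Nat.succ_le_succ (Nat.zero_le k)) (hzw ζ hζ _) (hzK ζ hζ) b b'
    have hconv : ∀ t : ℝ, 0 < t → t < 1 → ∃ l : ℂ, Tendsto (fun k => Dk k (t : ℂ) b b') atTop (𝓝 l) := by
      intro t ht0 ht1
      have hvt := abs_line_le L (u₀ := u₀) (u₁ := u₁) ht0 hv₀ hv₁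
      have hcoht := coherence_line_le L (ν₀ := ν₀) (ν₁ := ν₁) (s := s) ht0 hcoh₀ hcoh₁
      have htw : u₀ + t * u₁ ≤ w₁ := by nlinarith
      have htν : ν₀ + t * ν₁ ≤ w₁ := by nlinarith
      have htν0 : 0 ≤ ν₀ + t * ν₁ := by positivity
      obtain ⟨Dinf', Cinf', hDlim, -, -, -, -, -, -⟩ := H e (v₀ + t • v₁) (u₀ + t * u₁) (ν₀ + t * ν₁) s htν0 htν hs0 hs1 hvt htw hcoht
      refine ⟨(Dinf' b b' : ℂ), ?_⟩
      have h1 : Tendsto (fun k => ((kingTowerPot a m2 L (kingM d L e) (v₀ + t • v₁) (k + 1) b b' : ℝ) : ℂ)) atTop (𝓝 (Dinf' b b' : ℂ)) := by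
        have h0 := ((Complex.continuous_ofReal.tendsto _).comp (hDlim b b')).comp (tendsto_add_atTop_nat 1)
        refine h0.congr fun k => ?_
        simp only [Function.comp_apply, ← kingTower_add_fullPert (v₀ + t • v₁), Pi.add_apply]
      refine h1.congr fun k => ?_
      exact (kingLevelCPot_line_ofReal v₀ v₁ (Nat.succ_le_succ (Nat.zero_le k)) t b b').symm
    have hV := vitali_disc hR one_pos hd hb hconv
    exact ⟨hV.1, hV.2.2, fun ζ hζ => norm_vitaliLim_le hR one_pos hd hb hconv hζ⟩
  -- (B) the covariances along the line: part (§2) above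
  have hCov := H' e v₀ v₁ u₀ u₁ ν₀ ν₁ s hν₀ hν₁ hνwb hs0 hs1 hu₀ hu₁ hu₀K huwb hv₀ hv₁ hcoh₀ hcoh₁
  -- (C) the product identity at every level, and its limit
  have hz0 : 0 ≤ u₀ + ‖z‖ * u₁ := by positivity
  have hprod : ∀ k, (Dk k z + (kingBlock a L (kingM d L e)).map Complex.ofReal) * Ck k z = 1 := fun k =>
    Matrix.mul_nonsing_inv _ (isUnit_det_kingLevelCPot_add_block ha hm hL (Nat.succ_le_succ (Nat.zero_le k)) hz0 (hzw z hz _) (hzK z hz))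
  have hD : ∀ b b', Tendsto (fun k => Dk k z b b') atTop (𝓝 (Dinf b b')) := fun b b' => (hLev b b').2.1 z hz
  have hCv : ∀ x y, Tendsto (fun k => Ck k z x y) atTop (𝓝 (Cinf x y)) := fun x y => (hCov x y).2.2.1 z hz
  have hId : (Dinf + (kingBlock a L (kingM d L e)).map Complex.ofReal) * Cinf = 1 := by
    ext b y
    have hsum : Tendsto (fun k => ∑ w, (Dk k z b w + (kingBlock a L (kingM d L e)).map Complex.ofReal b w) * Ck k z w y) atTop
        (𝓝 (∑ w, (Dinf b w + (kingBlock a L (kingM d L e)).map Complex.ofReal b w) * Cinf w y)) :=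
      tendsto_finsetSum _ fun w _ => ((hD b w).add tendsto_const_nhds).mul (hCv w y)
    have hconst : ∀ k, ∑ w, (Dk k z b w + (kingBlock a L (kingM d L e)).map Complex.ofReal b w) * Ck k z w y
        = (1 : Matrix (Tor (kingU d L e)) (Tor (kingU d L e)) ℂ) b y := by
      intro k
      have h := congrFun (congrFun (hprod k) b) y
      rw [Matrix.mul_apply] at h
      simpa only [Matrix.add_apply] using h
    simp_rw [hconst] at hsum
    rw [Matrix.mul_apply]
    simp only [Matrix.add_apply]
    exact tendsto_nhds_unique hsum tendsto_const_nhds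
  have hinv : Cinf = (Dinf + (kingBlock a L (kingM d L e)).map Complex.ofReal)⁻¹ := (Matrix.inv_eq_right_inv hId).symm
  refine ⟨fun b b' => ⟨(hLev b b').1, hD b b', (hLev b b').2.2 z hz⟩, fun x y => ⟨(hCov x y).1, hCv x y, (hCov x y).2.2.2.2.1 z hz⟩, hId, hinv⟩

end Limit

end Summit.QuantumFields.YangMills.BalabanUVNodes.N15.KingModel

end
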